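import Mathlib
import Literature.Computability.Complexity.CliqueTestGraphs
import Summits.PneNP.PneNP.Theorems.ConvexRankGatesConvexGateBlindExponentDown

/-!
# PneNP / ConvexRankGates — `ConvexGateBlind`: sparsity of planted-dodging tests (LP slice, test-cover method)

Helpers (`--supports stmt-PneNP-10680`), continuing `ConvexRankGatesConvexGateBlindTestCover.lean`: there the LP slice
of the canonical form was reduced to valid TESTS `ψ_u` on the `k`-sets (`∑_Q ψ_u(Q) D[Q,u] ≤ 0 < ∑_Q ψ_u(Q)`,
`D[Q,u] = cdist Q u = #(E(Q) ∖ u)`) that no single `a ≥ 0` catches (`⟨ψ_u, a⟩ < 0`) on more than a superpolynomially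
small fraction of the columns. The cheapest attacks are PLANTED sets `a = 𝟙[K ⊆ Q]`, which catch iff the MARGINAL
`M(K) = ∑_{Q ⊇ K} ψ_u(Q)` (`testMarg`) is negative. Dodging them forces the test to be SPARSE:
* `sum_testMarg_insert`: the exact recursion `(k - j) · M(K) = ∑_{v ∉ K} M(K ∪ {v})` (`#K = j ≤ k`);
* `sum_mul_cdist_eq_sum_testMarg`, `testMarg_edge_eq_zero`: `∑_Q ψ(Q) D[Q,u] = ∑_{e ∉ u} M(e)`, so validity plus
  "no negative pair marginal" gives `M(e) = 0` on every non-edge of `u` (`posLevel_two_eq_empty`: `Pos_2 = ∅`);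
* `card_posLevel_succ_mul_le` (the step): with `Pos_j` = `j`-sets spanning a non-edge of `u` (`nonEdges`) with
  `M > 0` and `Neg_j` = `j`-sets with `M < 0`:  `(j - 1) · #Pos_{j+1} ≤ (m - j) · (#Pos_j + #Neg_j + (j+1) · #Neg_{j+1})`
  (a positive non-clique `(j+1)`-set has `≥ j - 1` non-clique `j`-subsets; each is positive, negative, or zero and
  then — its own term in the recursion being positive — lies under a NEGATIVE `(j+1)`-set);
* `card_support_le_card_posLevel_add`: for `k`-clique-free `u`, `#supp ψ ≤ #Pos_k + #Neg_k`. Unrolled from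
  `Pos_2 = ∅`: a test caught by uniformly planted sets with probability `< p` on every level is supported on an
  `O(k³ m p)` fraction of the `k`-sets; `card_support_le_of_properMarg_nonneg`: a FULL-DEPTH test (all proper
  marginals `≥ 0`) has `(k-2) · #supp ψ ≤ ((k-2) + k(m-k+1)) · #Neg_k`.
So in the regime of the crux (`m = k^{1/δ} ≪ e^k`) "uniform + corrections" designs are impossible: planted-dodging
tests live on superpolynomially rare `k`-sets (item evidence ANALYSIS-seat2-s5.md). [elementary double counting; new]
-/

namespace Summit.PneNP.PneNP.Theorems

open Finset Literature.Computability.Complexity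
open Summit.PneNP.PneNP.Cruxes.ConvexGateBlind.StrictRankConicCover (Edge cdist)

noncomputable section

variable {m : ℕ}

/-! ## Marginals of a test and the exact recursion -/

/-- The **marginal** of a test `ψ` (a function on the `k`-subsets of `Fin m`) at a set `K`:
`M(K) = ∑_{#Q = k, K ⊆ Q} ψ(Q)` — the pairing of `ψ` with the planted attack `𝟙[K ⊆ Q]`. [folklore] -/
def testMarg (k : ℕ) (ψ : Finset (Fin m) → ℝ) (K : Finset (Fin m)) : ℝ :=
  ∑ Q ∈ ((Finset.univ : Finset (Fin m)).powersetCard k).filter (fun Q => K ⊆ Q), ψ Q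

/-- At the top level the marginal is the test itself: `M(Q) = ψ(Q)` for `#Q = k`. [folklore] -/
theorem testMarg_of_card_eq {k : ℕ} (ψ : Finset (Fin m) → ℝ) {K : Finset (Fin m)} (hK : K.card = k) :
    testMarg k ψ K = ψ K := by
  unfold testMarg
  have hfilter : ((Finset.univ : Finset (Fin m)).powersetCard k).filter (fun Q => K ⊆ Q) = {K} := by
    ext Q
    simp only [mem_filter, mem_powersetCard, subset_univ, true_and, mem_singleton]
    constructor
    · rintro ⟨hQ, hKQ⟩
      exact (Finset.eq_of_subset_of_card_le hKQ (hQ.trans hK.symm).le).symm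
    · rintro rfl
      exact ⟨hK, Subset.rfl⟩
  rw [hfilter, sum_singleton]

/-- **The marginal recursion** (exact): for `#K = j ≤ k`,
`∑_{v ∉ K} M(K ∪ {v}) = (k - j) · M(K)` — each `k`-set `Q ⊇ K` is counted once for each of its `k - j` vertices
outside `K`. [folklore double counting] -/
theorem sum_testMarg_insert {k j : ℕ} (ψ : Finset (Fin m) → ℝ) {K : Finset (Fin m)} (hK : K.card = j)
    (hjk : j ≤ k) :
    ∑ v ∈ Kᶜ, testMarg k ψ (insert v K) = ((k : ℝ) - j) * testMarg k ψ K := by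
  classical
  unfold testMarg
  set F := ((Finset.univ : Finset (Fin m)).powersetCard k).filter (fun Q => K ⊆ Q) with hF
  have hinner : ∀ v ∈ Kᶜ,
      ∑ Q ∈ ((Finset.univ : Finset (Fin m)).powersetCard k).filter (fun Q => insert v K ⊆ Q), ψ Q =
        ∑ Q ∈ F, if v ∈ Q then ψ Q else 0 := by
    intro v _
    rw [Finset.sum_ite, Finset.sum_const_zero, add_zero]
    refine Finset.sum_congr ?_ (fun _ _ => rfl)
    ext Q
    simp only [hF, mem_filter, mem_powersetCard, subset_univ, true_and, Finset.insert_subset_iff]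
    tauto
  rw [Finset.sum_congr rfl hinner, Finset.sum_comm, Finset.mul_sum]
  refine Finset.sum_congr rfl fun Q hQ => ?_
  have hQ' := mem_filter.1 hQ
  have hQk : Q.card = k := (mem_powersetCard.1 hQ'.1).2
  have hKQ : K ⊆ Q := hQ'.2
  rw [Finset.sum_ite, Finset.sum_const_zero, add_zero, Finset.sum_const, nsmul_eq_mul]
  have hset : Kᶜ.filter (fun v => v ∈ Q) = Q \ K := by
    ext v
    simp only [mem_filter, mem_compl, mem_sdiff]
    tauto
  rw [hset, card_sdiff_of_subset hKQ, hQk, hK, Nat.cast_sub hjk]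

/-! ## Edges, non-edges, and the level-2 identity -/

/-- The two endpoints of an edge of `K_m`, as a `Finset`. [folklore] -/
def edgeVerts (e : Edge m) : Finset (Fin m) := Finset.univ.filter (fun v => v ∈ (e : Sym2 (Fin m)))

/-- `cliqueVec S e = true` iff both endpoints of `e` lie in `S`. [folklore] -/
theorem cliqueVec_eq_true_iff_edgeVerts_subset (S : Finset (Fin m)) (e : Edge m) :
    cliqueVec S e = true ↔ edgeVerts e ⊆ S := by
  simp only [cliqueVec, decide_eq_true_eq]
  constructor
  · intro h v hv
    rw [edgeVerts, mem_filter] at hv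
    exact h v hv.2
  · intro h v hv
    exact h (by rw [edgeVerts, mem_filter]; exact ⟨mem_univ _, hv⟩)

/-- An edge has exactly two endpoints. [folklore] -/
theorem card_edgeVerts (e : Edge m) : (edgeVerts e).card = 2 := by
  rcases e with ⟨s, hs⟩
  revert hs
  refine Sym2.ind (fun a b => ?_) s
  intro hs
  have hab : a ≠ b := by simpa using hs
  have hset : edgeVerts ⟨s(a, b), hs⟩ = {a, b} := by
    ext v
    simp only [edgeVerts, mem_filter, mem_univ, true_and, Sym2.mem_iff, mem_insert, mem_singleton]
  rw [hset, card_pair hab]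

/-- The **non-edges of `u` spanned by `K`**: the edges of `K_m` that are off in `u` and have both endpoints in `K`
(so `D[K,u] = #(nonEdges u K)`; `K` is a clique of `u` iff this is empty). [folklore] -/
def nonEdges (u : Edge m → Bool) (K : Finset (Fin m)) : Finset (Edge m) :=
  Finset.univ.filter (fun e => u e = false ∧ edgeVerts e ⊆ K)

/-- Membership in `nonEdges`. [folklore] -/
theorem mem_nonEdges {u : Edge m → Bool} {K : Finset (Fin m)} {e : Edge m} :
    e ∈ nonEdges u K ↔ u e = false ∧ edgeVerts e ⊆ K := by
  simp only [nonEdges, mem_filter, mem_univ, true_and]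

/-- Spanning a non-edge is monotone in the set. [folklore] -/
theorem nonEdges_mono {u : Edge m → Bool} {K K' : Finset (Fin m)} (hKK' : K ⊆ K') :
    nonEdges u K ⊆ nonEdges u K' := by
  intro e he
  exact mem_nonEdges.2 ⟨(mem_nonEdges.1 he).1, (mem_nonEdges.1 he).2.trans hKK'⟩

/-- For a `k`-clique-free `u`, every `k`-set spans a non-edge. [folklore] -/
theorem nonEdges_nonempty_of_cliqueFn_eq_false {k : ℕ} {u : Edge m → Bool} (hu : cliqueFn m k u = false)
    {Q : Finset (Fin m)} (hQ : Q.card = k) : (nonEdges u Q).Nonempty := by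
  rw [cliqueFn_eq_false_iff] at hu
  have hnc : ¬ (cliqueGraph u).IsNClique k Q := hu Q
  rw [SimpleGraph.isNClique_iff] at hnc
  have hncl : ¬ (cliqueGraph u).IsClique (Q : Set (Fin m)) := fun h => hnc ⟨h, hQ⟩
  rw [SimpleGraph.isClique_iff, Set.Pairwise] at hncl
  push Not at hncl
  obtain ⟨a, ha, b, hb, hab, hadj⟩ := hncl
  rw [cliqueGraph_adj] at hadj
  push Not at hadj
  refine ⟨⟨s(a, b), by simpa using hab⟩, mem_nonEdges.2 ⟨?_, ?_⟩⟩
  · simpa using hadj hab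
  · intro v hv
    simp only [edgeVerts, mem_filter, mem_univ, true_and, Sym2.mem_iff] at hv
    rcases hv with rfl | rfl
    · exact Finset.mem_coe.1 ha
    · exact Finset.mem_coe.1 hb

/-- **Level-2 identity.** `∑_{#Q=k} ψ(Q) D[Q,u] = ∑_{e ∉ u} M(e)`: pairing a test with the column `u` of the
clique-distance matrix is the sum of its PAIR marginals over the non-edges of `u`. [folklore] -/
theorem sum_mul_cdist_eq_sum_testMarg (k : ℕ) (ψ : Finset (Fin m) → ℝ) (u : Edge m → Bool) :
    ∑ Q ∈ (Finset.univ : Finset (Fin m)).powersetCard k, ψ Q * cdist Q u =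
      ∑ e : Edge m, if u e = false then testMarg k ψ (edgeVerts e) else 0 := by
  classical
  unfold cdist
  simp_rw [Finset.mul_sum]
  rw [Finset.sum_comm]
  refine Finset.sum_congr rfl fun e _ => ?_
  by_cases hu : u e = false
  · rw [if_pos hu]
    unfold testMarg
    rw [Finset.sum_filter]
    refine Finset.sum_congr rfl fun Q _ => ?_
    by_cases hQ : edgeVerts e ⊆ Q
    · rw [if_pos hQ, if_pos ⟨(cliqueVec_eq_true_iff_edgeVerts_subset Q e).2 hQ, hu⟩, mul_one]
    · rw [if_neg hQ, if_neg (fun h => hQ ((cliqueVec_eq_true_iff_edgeVerts_subset Q e).1 h.1)), mul_zero]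
  · rw [if_neg hu]
    refine Finset.sum_eq_zero fun Q _ => ?_
    rw [if_neg (fun h => hu h.2), mul_zero]

/-- **Tight level 2.** If `∑_Q ψ(Q) D[Q,u] ≤ 0` (the `D`-half of validity) and no non-edge of `u` has a negative pair
marginal, then EVERY non-edge of `u` has pair marginal exactly `0`. [folklore] -/
theorem testMarg_edge_eq_zero {k : ℕ} (ψ : Finset (Fin m) → ℝ) (u : Edge m → Bool)
    (hD : ∑ Q ∈ (Finset.univ : Finset (Fin m)).powersetCard k, ψ Q * cdist Q u ≤ 0)
    (hnn : ∀ e : Edge m, u e = false → 0 ≤ testMarg k ψ (edgeVerts e)) :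
    ∀ e : Edge m, u e = false → testMarg k ψ (edgeVerts e) = 0 := by
  rw [sum_mul_cdist_eq_sum_testMarg] at hD
  have hterm : ∀ e ∈ (Finset.univ : Finset (Edge m)),
      0 ≤ (if u e = false then testMarg k ψ (edgeVerts e) else 0) := fun e _ => by
    split_ifs with h
    exacts [hnn e h, le_rfl]
  intro e he
  have := (Finset.sum_eq_zero_iff_of_nonneg hterm).1 (le_antisymm hD (Finset.sum_nonneg hterm)) e (mem_univ _)
  rwa [if_pos he] at this

/-! ## Positive and negative levels; the base and the step -/

open Classical in
/-- `Pos_j`: the `j`-subsets of `Fin m` that span a non-edge of `u` and have POSITIVE marginal. (Positive marginals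
on cliques of `u` are harmless and not counted.) [new packaging] -/
def posLevel (u : Edge m → Bool) (k : ℕ) (ψ : Finset (Fin m) → ℝ) (j : ℕ) : Finset (Finset (Fin m)) :=
  ((Finset.univ : Finset (Fin m)).powersetCard j).filter (fun K => (nonEdges u K).Nonempty ∧ 0 < testMarg k ψ K)

open Classical in
/-- `Neg_j`: the `j`-subsets of `Fin m` with NEGATIVE marginal — exactly the planted `j`-sets that catch the test.
[new packaging] -/
def negLevel (k : ℕ) (ψ : Finset (Fin m) → ℝ) (j : ℕ) : Finset (Finset (Fin m)) :=
  ((Finset.univ : Finset (Fin m)).powersetCard j).filter (fun K => testMarg k ψ K < 0)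

open Classical in
/-- Membership in `Pos_j`. [new packaging] -/
theorem mem_posLevel {u : Edge m → Bool} {k : ℕ} {ψ : Finset (Fin m) → ℝ} {j : ℕ} {K : Finset (Fin m)} :
    K ∈ posLevel u k ψ j ↔ K.card = j ∧ (nonEdges u K).Nonempty ∧ 0 < testMarg k ψ K := by
  simp only [posLevel, mem_filter, mem_powersetCard, subset_univ, true_and]

open Classical in
/-- Membership in `Neg_j`. [new packaging] -/
theorem mem_negLevel {k : ℕ} {ψ : Finset (Fin m) → ℝ} {j : ℕ} {K : Finset (Fin m)} :
    K ∈ negLevel k ψ j ↔ K.card = j ∧ testMarg k ψ K < 0 := by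
  simp only [negLevel, mem_filter, mem_powersetCard, subset_univ, true_and]

/-- **Base.** A test with `∑_Q ψ(Q) D[Q,u] ≤ 0` and no negative pair marginal (`Neg_2 = ∅`) has `Pos_2 = ∅`: no
non-edge of `u` carries a positive pair marginal. [new packaging] -/
theorem posLevel_two_eq_empty {k : ℕ} (ψ : Finset (Fin m) → ℝ) (u : Edge m → Bool)
    (hD : ∑ Q ∈ (Finset.univ : Finset (Fin m)).powersetCard k, ψ Q * cdist Q u ≤ 0)
    (hneg : negLevel k ψ 2 = ∅) : posLevel u k ψ 2 = ∅ := by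
  have hnn : ∀ e : Edge m, u e = false → 0 ≤ testMarg k ψ (edgeVerts e) := by
    intro e _
    by_contra hlt
    push Not at hlt
    have hmem : edgeVerts e ∈ negLevel k ψ 2 := mem_negLevel.2 ⟨card_edgeVerts e, hlt⟩
    rw [hneg] at hmem
    exact Finset.notMem_empty _ hmem
  have hzero := testMarg_edge_eq_zero ψ u hD hnn
  rw [Finset.eq_empty_iff_forall_notMem]
  intro K hK
  obtain ⟨hK2, ⟨e, he⟩, hpos⟩ := mem_posLevel.1 hK
  obtain ⟨he, heK⟩ := mem_nonEdges.1 he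
  have hEq : edgeVerts e = K := Finset.eq_of_subset_of_card_le heK (by rw [card_edgeVerts, hK2])
  rw [← hEq, hzero e he] at hpos
  exact lt_irrefl _ hpos

/-- **Step (the sparsity recursion).** For every `j` with `j + 1 ≤ k` (vacuous for `j ≤ 1`):
`(j - 1) · #Pos_{j+1} ≤ (m - j) · (#Pos_j + #Neg_j + (j+1) · #Neg_{j+1})`.
Proof: double count the pairs `K ⊂ K'` with `K' ∈ Pos_{j+1}` and `K` one of its `≥ j - 1` `j`-subsets that still span the
non-edge; such a `K` is in `Pos_j`, in `Neg_j`, or has `M(K) = 0`, and then the recursion `sum_testMarg_insert` — whose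
`K'`-term is positive — produces a negative `(j+1)`-set above `K`; every `j`-set lies under at most `m - j` sets of the
next level. [elementary double counting; new] -/
theorem card_posLevel_succ_mul_le : ∀ {m k j : ℕ} (ψ : Finset (Fin m) → ℝ) (u : Edge m → Bool), j + 1 ≤ k →
    (posLevel u k ψ (j + 1)).card * (j - 1) ≤
      ((posLevel u k ψ j).card + (negLevel k ψ j).card + (j + 1) * (negLevel k ψ (j + 1)).card) * (m - j) := by
  intro m k j ψ u hjk
  classical
  set s := posLevel u k ψ (j + 1) with hs
  set T := (negLevel k ψ (j + 1)).biUnion (fun K' => K'.powersetCard j) with hT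
  set t := (posLevel u k ψ j ∪ negLevel k ψ j) ∪ T with ht
  -- size of the base family
  have htcard : t.card ≤ (posLevel u k ψ j).card + (negLevel k ψ j).card + (j + 1) * (negLevel k ψ (j + 1)).card := by
    have hTcard : T.card ≤ (j + 1) * (negLevel k ψ (j + 1)).card := by
      calc T.card ≤ ∑ K' ∈ negLevel k ψ (j + 1), (K'.powersetCard j).card := card_biUnion_le
        _ = ∑ K' ∈ negLevel k ψ (j + 1), (j + 1) := by
            refine sum_congr rfl fun K' hK' => ?_
            rw [card_powersetCard, (mem_negLevel.1 hK').1]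
            exact Nat.choose_succ_self_right j
        _ = (j + 1) * (negLevel k ψ (j + 1)).card := by rw [sum_const, smul_eq_mul, mul_comm]
    calc t.card ≤ (posLevel u k ψ j ∪ negLevel k ψ j).card + T.card := card_union_le _ _
      _ ≤ ((posLevel u k ψ j).card + (negLevel k ψ j).card) + T.card := by
          gcongr
          exact card_union_le _ _
      _ ≤ _ := by gcongr
  -- every member of the base family is a `j`-set
  have hmemt : ∀ K ∈ t, K.card = j := by
    intro K hK
    rcases mem_union.1 hK with hK | hK
    · rcases mem_union.1 hK with hK | hK
      · exact (mem_posLevel.1 hK).1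
      · exact (mem_negLevel.1 hK).1
    · obtain ⟨K', -, hKK'⟩ := mem_biUnion.1 hK
      exact (mem_powersetCard.1 hKK').2
  -- (a) below every `K' ∈ Pos_{j+1}` lie at least `j - 1` members of `t`
  have habove : ∀ K' ∈ s, j - 1 ≤ (t.bipartiteAbove (fun K' K => K ⊆ K') K').card := by
    intro K' hK'
    obtain ⟨hK'card, ⟨e, he⟩, hpos⟩ := mem_posLevel.1 hK'
    obtain ⟨he, heK'⟩ := mem_nonEdges.1 he
    -- the `j`-subsets `K'.erase v`, `v` not an endpoint of the non-edge
    have hBcard : ((K' \ edgeVerts e).image fun v => K'.erase v).card = j - 1 := by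
      rw [card_image_of_injOn, card_sdiff_of_subset heK', hK'card, card_edgeVerts]
      · rfl
      · intro v hv w hw hvw
        exact (Finset.erase_inj K' (mem_sdiff.1 (mem_coe.1 hv)).1).1 hvw
    rw [← hBcard]
    refine card_le_card fun K hK => ?_
    obtain ⟨v, hv, rfl⟩ := mem_image.1 hK
    have hvK' : v ∈ K' := (mem_sdiff.1 hv).1
    have hve : v ∉ edgeVerts e := (mem_sdiff.1 hv).2
    have hKcard : (K'.erase v).card = j := by rw [card_erase_of_mem hvK', hK'card]; rfl
    have hKne : (nonEdges u (K'.erase v)).Nonempty := ⟨e, mem_nonEdges.2 ⟨he, subset_erase.2 ⟨heK', hve⟩⟩⟩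
    rw [mem_bipartiteAbove]
    refine ⟨?_, erase_subset v K'⟩
    rcases lt_trichotomy (testMarg k ψ (K'.erase v)) 0 with hlt | heq | hgt
    · exact mem_union_left _ (mem_union_right _ (mem_negLevel.2 ⟨hKcard, hlt⟩))
    · -- `M(K) = 0`: the recursion forces a negative `(j+1)`-set above `K`
      have hrec := sum_testMarg_insert ψ hKcard (by omega : j ≤ k)
      rw [heq, mul_zero] at hrec
      have hex : ∃ w ∈ (K'.erase v)ᶜ, testMarg k ψ (insert w (K'.erase v)) < 0 := by
        by_contra hcon
        push Not at hcon
        have hle := Finset.single_le_sum hcon (mem_compl.2 (notMem_erase v K'))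
        rw [insert_erase hvK', hrec] at hle
        exact absurd hle (not_le.2 hpos)
      obtain ⟨w, hw, hneg⟩ := hex
      have hwK : w ∉ K'.erase v := mem_compl.1 hw
      refine mem_union_right _ (mem_biUnion.2 ⟨insert w (K'.erase v), mem_negLevel.2 ⟨?_, hneg⟩, ?_⟩)
      · rw [card_insert_of_notMem hwK, hKcard]
      · exact mem_powersetCard.2 ⟨subset_insert _ _, hKcard⟩
    · exact mem_union_left _ (mem_union_left _ (mem_posLevel.2 ⟨hKcard, hKne, hgt⟩))
  -- (b) above every `K ∈ t` lie at most `m - j` sets of the next level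
  have hbelow : ∀ K ∈ t, (s.bipartiteBelow (fun K' K => K ⊆ K') K).card ≤ m - j := by
    intro K hK
    have hKcard := hmemt K hK
    calc (s.bipartiteBelow (fun K' K => K ⊆ K') K).card
        ≤ (Kᶜ.image fun w => insert w K).card := by
          refine card_le_card fun K' hK' => ?_
          rw [mem_bipartiteBelow] at hK'
          obtain ⟨hK's, hKK'⟩ := hK'
          have hK'card : K'.card = j + 1 := (mem_posLevel.1 hK's).1
          have hdiff : (K' \ K).card = 1 := by rw [card_sdiff_of_subset hKK', hK'card, hKcard]; omega
          obtain ⟨w, hw⟩ := card_eq_one.1 hdiff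
          refine mem_image.2 ⟨w, ?_, ?_⟩
          · have : w ∈ K' \ K := by rw [hw]; exact mem_singleton_self w
            exact mem_compl.2 (mem_sdiff.1 this).2
          · rw [← union_sdiff_of_subset hKK', hw, union_comm]
            rfl
      _ ≤ Kᶜ.card := card_image_le
      _ = m - j := by rw [card_compl, Fintype.card_fin, hKcard]
  calc s.card * (j - 1) ≤ t.card * (m - j) := card_mul_le_card_mul _ habove hbelow
    _ ≤ _ := Nat.mul_le_mul_right _ htcard

/-! ## Level `k`: the support of the test -/

open Classical in
/-- **The support sits in `Pos_k ∪ Neg_k`.** For a `k`-clique-free `u`, every `k`-set spans a non-edge, and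
`M(Q) = ψ(Q)` at level `k`; hence `#supp ψ ≤ #Pos_k + #Neg_k`. [new packaging] -/
theorem card_support_le_card_posLevel_add {k : ℕ} (ψ : Finset (Fin m) → ℝ) {u : Edge m → Bool}
    (hu : cliqueFn m k u = false) :
    (((Finset.univ : Finset (Fin m)).powersetCard k).filter (fun Q => ψ Q ≠ 0)).card ≤
      (posLevel u k ψ k).card + (negLevel k ψ k).card := by
  calc _ ≤ (posLevel u k ψ k ∪ negLevel k ψ k).card := by
        refine card_le_card fun Q hQ => ?_
        rw [mem_filter, mem_powersetCard] at hQ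
        obtain ⟨⟨-, hQk⟩, hne⟩ := hQ
        have hm : testMarg k ψ Q = ψ Q := testMarg_of_card_eq ψ hQk
        rcases lt_trichotomy (ψ Q) 0 with hlt | heq | hgt
        · exact mem_union_right _ (mem_negLevel.2 ⟨hQk, by rwa [hm]⟩)
        · exact absurd heq hne
        · exact mem_union_left _ (mem_posLevel.2 ⟨hQk, nonEdges_nonempty_of_cliqueFn_eq_false hu hQk, by rwa [hm]⟩)
    _ ≤ _ := card_union_le _ _

/-- **No negative proper marginals ⟹ no positive non-clique proper marginals.** If `∑_Q ψ(Q) D[Q,u] ≤ 0` and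
`Neg_j = ∅` for all `2 ≤ j ≤ k - 1`, then `Pos_j = ∅` for all `2 ≤ j ≤ k - 1` (induction on the step from the base).
[new] -/
theorem posLevel_eq_empty_of_negLevel_eq_empty {k : ℕ} (ψ : Finset (Fin m) → ℝ) (u : Edge m → Bool)
    (hD : ∑ Q ∈ (Finset.univ : Finset (Fin m)).powersetCard k, ψ Q * cdist Q u ≤ 0)
    (hneg : ∀ j, 2 ≤ j → j + 1 ≤ k → negLevel k ψ j = ∅) :
    ∀ j, 2 ≤ j → j + 1 ≤ k → posLevel u k ψ j = ∅ := by
  intro j hj2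
  induction j, hj2 using Nat.le_induction with
  | base => exact fun hk => posLevel_two_eq_empty ψ u hD (hneg 2 le_rfl hk)
  | succ j hj2 ih =>
    intro hjk
    have hstep := card_posLevel_succ_mul_le ψ u (k := k) (j := j) (by omega)
    rw [ih (by omega), hneg j hj2 (by omega), hneg (j + 1) (by omega) hjk] at hstep
    simp only [card_empty, mul_zero, add_zero, zero_mul] at hstep
    rcases Nat.mul_eq_zero.1 (Nat.eq_zero_of_le_zero hstep) with h | h
    · exact card_eq_zero.1 h
    · omega

open Classical in
/-- **Full-depth tests are supported near their negative part.** Let `u` be `k`-clique-free (`3 ≤ k`) and let `ψ`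
satisfy `∑_Q ψ(Q) D[Q,u] ≤ 0` with NO negative proper marginal (`Neg_j = ∅`, `2 ≤ j ≤ k-1`: no planted set of size
`< k` catches it). Then `(k - 2) · #supp ψ ≤ ((k - 2) + k · (m - (k-1))) · #Neg_k`, i.e. the support of `ψ` is at most
`O(m)` times the number of its negative entries — so its density among the `k`-sets is at most `O(m)` times the
(superpolynomially small) atom-catch probability. [new] -/
theorem card_support_le_of_properMarg_nonneg {k : ℕ} (hk : 3 ≤ k) (ψ : Finset (Fin m) → ℝ) {u : Edge m → Bool}
    (hu : cliqueFn m k u = false)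
    (hD : ∑ Q ∈ (Finset.univ : Finset (Fin m)).powersetCard k, ψ Q * cdist Q u ≤ 0)
    (hneg : ∀ j, 2 ≤ j → j + 1 ≤ k → negLevel k ψ j = ∅) :
    (k - 2) * (((Finset.univ : Finset (Fin m)).powersetCard k).filter (fun Q => ψ Q ≠ 0)).card ≤
      ((k - 2) + k * (m - (k - 1))) * (negLevel k ψ k).card := by
  have hsupp := card_support_le_card_posLevel_add ψ hu
  have hstep := card_posLevel_succ_mul_le ψ u (k := k) (j := k - 1) (by omega)
  have hk1 : k - 1 + 1 = k := by omega
  rw [hk1, posLevel_eq_empty_of_negLevel_eq_empty ψ u hD hneg (k - 1) (by omega) (by omega),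
    hneg (k - 1) (by omega) (by omega), card_empty, zero_add, zero_add] at hstep
  have hk2 : k - 1 - 1 = k - 2 := by omega
  rw [hk2] at hstep
  -- hstep : #Pos_k * (k-2) ≤ (k * #Neg_k) * (m - (k-1))
  calc (k - 2) * (((Finset.univ : Finset (Fin m)).powersetCard k).filter (fun Q => ψ Q ≠ 0)).card
      ≤ (k - 2) * ((posLevel u k ψ k).card + (negLevel k ψ k).card) := Nat.mul_le_mul_left _ hsupp
    _ = (posLevel u k ψ k).card * (k - 2) + (k - 2) * (negLevel k ψ k).card := by ring
    _ ≤ (k * (negLevel k ψ k).card) * (m - (k - 1)) + (k - 2) * (negLevel k ψ k).card := by gcongr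
    _ = ((k - 2) + k * (m - (k - 1))) * (negLevel k ψ k).card := by ring

end

end Summit.PneNP.PneNP.Theorems
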